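import Summits.Parity.BatemanHorn.Theses.IsogenyRedei
import Literature.NumberTheory.LFunctions.MertensConstant
import Summits.Parity.BatemanHorn.Theorems.BalancedSemiprimeLayer.Negative.TightAtX

/-!
# `PolyMobiusTail` (crux stmt-Parity-0870): the `o(x)` is cancellation ACROSS `n`

Negative-side lemmas (cdisprove seat refuter-cdisprove-stmt-Parity-0870-0), all PROVED, about the crux
function `Tail_η(f; x) = ∑_{n ≤ x} ∑_{dᵢ ∣ fᵢ(n), x^{1-η} < ∏ dᵢ} ∏ᵢ μ(dᵢ) log dᵢ` at the prime-number-theorem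
system `f = (X)`:

* `tail_X_one_eq_neg_psi` — at the closed endpoint `η = 1` the tail of `(X)` is `-ψ(x)` exactly, hence
  (`polyMobiusTail_tight_at_eta_one`, Chebyshev's `ψ(x) ≥ x log 2 - log(x+1)`) NOT `o(x)`: the range
  `η < 1` of the crux cannot be closed, and the strengthening `∀ η ∈ (0, 1]` is false
  (`polyMobiusTail_allEtaClosed_false`);
* `polyMobiusTail_abs_false` — with absolute values around each inner divisor sum the statement fails for
  `(X)` at EVERY `η > 0`: each prime `p ∈ (x^{1-η}, x]` contributes `|μ(p) log p| = log p`, in total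
  `≥ θ(x) - θ(x^{1-η}) ≫ x` (`sum_log_le_absTail_X`, `theta_sub_le_sum_log`). So any proof of the crux must
  use cancellation BETWEEN different `n` (prime `n` against composite `n`); bounding each inner sum is hopeless.
* `polyMobiusTail_primeDivisors_false` — restricting the divisor tuples to PRIME `d` (`primeFactors` in
  place of `divisors`) also fails for `(X)` at every `η ∈ (0,1)`: the prime-divisor tail is
  `-∑_{x^{1-η} < p ≤ x} log p ⌊x/p⌋ ≤ -x(η log x - 8 - log 4)` (`primeTail_X_eq`, `primeTail_X_lower`, from
  the tree's two-sided Mertens I `Literature.NumberTheory.LFunctions.Mertens.abs_mertensTau_le`). So the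
  cancellation also runs across the divisor lattice (prime against composite `d`).
-/

namespace Summit.Parity.BatemanHorn.Theorems.PolyMobiusTail.Negative

open scoped BigOperators
open Filter Asymptotics Polynomial ArithmeticFunction
open Literature.NumberTheory.Sieve
open Summit.Parity.BatemanHorn.Theorems.BalancedSemiprimeLayer.Negative (isBatemanHornSystem_X)

/-- Sums over `Fintype.piFinset` of a `Fin 1`-indexed family are sums over the single factor. [folklore] -/
theorem sum_piFinset_fin_one (t : Fin 1 → Finset ℕ) (G : ℕ → ℝ) :
    ∑ d ∈ Fintype.piFinset t, G (d 0) = ∑ j ∈ t 0, G j := by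
  have h := Finset.prod_univ_sum t (fun _ j => G j)
  simp only [Fin.prod_univ_one] at h
  exact h.symm

/-- The crux function on a one-polynomial system `![g]`, with the `Fin 1` bookkeeping removed. [folklore] -/
theorem tail_fin_one (g : ℤ[X]) (η : ℝ) (x : ℕ) :
    (∑ n ∈ Finset.Icc 1 x, ∑ d ∈ Fintype.piFinset (fun i => (((![g] i).eval (n : ℤ)).toNat).divisors),
      if (x : ℝ) ^ (1 - η) < ∏ i, (d i : ℝ) then ∏ i, ((moebius (d i) : ℝ) * Real.log (d i)) else 0)
    = ∑ n ∈ Finset.Icc 1 x, ∑ d ∈ ((g.eval (n : ℤ)).toNat).divisors,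
      if (x : ℝ) ^ (1 - η) < (d : ℝ) then (moebius d : ℝ) * Real.log d else 0 := by
  refine Finset.sum_congr rfl fun n _ => ?_
  simp only [Fin.prod_univ_one, Matrix.cons_val_fin_one]
  exact sum_piFinset_fin_one (fun _ => ((g.eval (n : ℤ)).toNat).divisors)
    (fun j => if (x : ℝ) ^ (1 - η) < (j : ℝ) then (moebius j : ℝ) * Real.log j else 0)

/-- At `η = 1` the tail of the system `(X)` is `-ψ(x)`: the bracket `1 < d` only removes `d = 1`, whose
weight `μ(1) log 1` vanishes, and `∑_{d ∣ n} μ(d) log d = -Λ(n)`. [folklore] -/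
theorem tail_X_one_eq_neg_psi (x : ℕ) :
    (∑ n ∈ Finset.Icc 1 x, ∑ d ∈ Fintype.piFinset (fun i => (((![(X : ℤ[X])] i).eval (n : ℤ)).toNat).divisors),
      if (x : ℝ) ^ (1 - (1 : ℝ)) < ∏ i, (d i : ℝ) then ∏ i, ((moebius (d i) : ℝ) * Real.log (d i)) else 0)
    = -Chebyshev.psi x := by
  rw [tail_fin_one]
  have hx : ((x : ℝ)) ^ ((1 : ℝ) - 1) = 1 := by rw [sub_self, Real.rpow_zero]
  simp only [eval_X, Int.toNat_natCast, hx]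
  have inner : ∀ n : ℕ, (∑ d ∈ n.divisors, if (1 : ℝ) < (d : ℝ) then (moebius d : ℝ) * Real.log d else 0)
      = -vonMangoldt n := by
    intro n
    rw [← sum_moebius_mul_log_eq]
    refine Finset.sum_congr rfl fun d hd => ?_
    have hd1 : 1 ≤ d := Nat.pos_of_mem_divisors hd
    rcases hd1.eq_or_lt with h | h
    · subst h; simp
    · have : (1 : ℝ) < (d : ℝ) := by exact_mod_cast h
      simp [this, ArithmeticFunction.log_apply]
  simp only [inner, Finset.sum_neg_distrib, Chebyshev.psi, Nat.floor_natCast]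
  congr 1

/-- Chebyshev's lower bound `ψ(x) ≥ x log 2 - log(x+1)` makes `-ψ` NOT `o(x)` along `ℕ`. [folklore] -/
theorem not_isLittleO_neg_psi :
    ¬ (fun x : ℕ => -Chebyshev.psi x) =o[atTop] (fun x : ℕ => (x : ℝ)) := by
  intro h
  have hlog : (fun x : ℕ => Real.log ((x : ℝ) + 1)) =o[atTop] (fun x : ℕ => (x : ℝ)) := by
    have h1 : (fun y : ℝ => Real.log (y + 1)) =o[atTop] (fun y : ℝ => y + 1) :=
      Real.isLittleO_log_id_atTop.comp_tendsto (tendsto_atTop_add_const_right _ 1 tendsto_id)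
    have h2 : (fun y : ℝ => y + 1) =O[atTop] (fun y : ℝ => y) := by
      refine IsBigO.of_bound 2 ?_
      filter_upwards [eventually_ge_atTop (1 : ℝ)] with y hy
      rw [Real.norm_eq_abs, Real.norm_eq_abs, abs_of_nonneg (by linarith), abs_of_nonneg (by linarith)]
      linarith
    exact (h1.trans_isBigO h2).comp_tendsto tendsto_natCast_atTop_atTop
  have hbig : (fun x : ℕ => (x : ℝ)) =O[atTop] (fun x : ℕ => -Chebyshev.psi x) := by
    refine IsBigO.of_bound (2 / Real.log 2) ?_
    have hl2 : 0 < Real.log 2 := Real.log_pos one_lt_two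
    filter_upwards [hlog.def (half_pos hl2), eventually_ge_atTop 1] with x hx hx1
    rw [Real.norm_eq_abs, Real.norm_eq_abs, abs_of_nonneg (Real.log_nonneg (by simp)),
      abs_of_nonneg (Nat.cast_nonneg x)] at hx
    have hψ := Chebyshev.psi_ge x
    rw [Real.norm_eq_abs, abs_of_nonneg (Nat.cast_nonneg x), norm_neg, Real.norm_eq_abs,
      abs_of_nonneg (Chebyshev.psi_nonneg _)]
    rw [div_mul_eq_mul_div, le_div_iff₀ hl2]
    nlinarith
  have := hbig.trans_isLittleO h
  exact isLittleO_irrefl (by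
    refine Filter.Eventually.frequently ?_
    filter_upwards [eventually_ge_atTop 1] with x hx
    simp; omega) this

/-- **Tightness of `PolyMobiusTail` at `η = 1`.** For the BH system `(X)` the crux function at the closed
endpoint `η = 1` is `-ψ(x)`, which is not `o(x)`. [folklore] -/
theorem polyMobiusTail_tight_at_eta_one :
    ¬ (fun x : ℕ => ∑ n ∈ Finset.Icc 1 x,
        ∑ d ∈ Fintype.piFinset (fun i => (((![(X : ℤ[X])] i).eval (n : ℤ)).toNat).divisors),
          if (x : ℝ) ^ (1 - (1 : ℝ)) < ∏ i, (d i : ℝ) then ∏ i, ((moebius (d i) : ℝ) * Real.log (d i)) else 0)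
      =o[atTop] (fun x : ℕ => (x : ℝ)) := by
  simp_rw [tail_X_one_eq_neg_psi]
  exact not_isLittleO_neg_psi

/-- **The strengthening `∀ η ∈ (0, 1]` of `PolyMobiusTail` is false** (witness `f = (X)`, `η = 1`). [folklore] -/
theorem polyMobiusTail_allEtaClosed_false :
    ¬ ∀ (k : ℕ) (f : Fin k → ℤ[X]), IsBatemanHornSystem f → ∀ η : ℝ, 0 < η → η ≤ 1 →
      (fun x : ℕ => ∑ n ∈ Finset.Icc 1 x,
        ∑ d ∈ Fintype.piFinset (fun i => (((f i).eval (n : ℤ)).toNat).divisors),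
          if (x : ℝ) ^ (1 - η) < ∏ i, (d i : ℝ) then ∏ i, ((moebius (d i) : ℝ) * Real.log (d i)) else 0)
      =o[atTop] (fun x : ℕ => (x : ℝ)) := fun h =>
  polyMobiusTail_tight_at_eta_one (h 1 ![X] isBatemanHornSystem_X 1 one_pos le_rfl)

/-! ### Absolute values around the inner divisor sums -/

/-- Primes `p ≤ x` beyond the cut-off each contribute `|μ(p) log p| = log p` to the absolute tail of `(X)`. [folklore] -/
theorem sum_log_le_absTail_X (η : ℝ) (x : ℕ) :
    ∑ p ∈ (Finset.Icc 1 x).filter (fun p : ℕ => p.Prime ∧ (x : ℝ) ^ (1 - η) < (p : ℝ)), Real.log p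
      ≤ ∑ n ∈ Finset.Icc 1 x, |∑ d ∈ Fintype.piFinset (fun i => (((![(X : ℤ[X])] i).eval (n : ℤ)).toNat).divisors),
          if (x : ℝ) ^ (1 - η) < ∏ i, (d i : ℝ) then ∏ i, ((moebius (d i) : ℝ) * Real.log (d i)) else 0| := by
  have hred : ∀ n : ℕ, (∑ d ∈ Fintype.piFinset (fun i => (((![(X : ℤ[X])] i).eval (n : ℤ)).toNat).divisors),
        if (x : ℝ) ^ (1 - η) < ∏ i, (d i : ℝ) then ∏ i, ((moebius (d i) : ℝ) * Real.log (d i)) else 0)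
      = ∑ d ∈ n.divisors, if (x : ℝ) ^ (1 - η) < (d : ℝ) then (moebius d : ℝ) * Real.log d else 0 := by
    intro n
    simp only [Fin.prod_univ_one, Matrix.cons_val_fin_one, eval_X, Int.toNat_natCast]
    exact sum_piFinset_fin_one (fun _ => n.divisors)
      (fun j => if (x : ℝ) ^ (1 - η) < (j : ℝ) then (moebius j : ℝ) * Real.log j else 0)
  simp only [hred]
  calc ∑ p ∈ (Finset.Icc 1 x).filter (fun p : ℕ => p.Prime ∧ (x : ℝ) ^ (1 - η) < (p : ℝ)), Real.log p
      = ∑ p ∈ (Finset.Icc 1 x).filter (fun p : ℕ => p.Prime ∧ (x : ℝ) ^ (1 - η) < (p : ℝ)),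
          |∑ d ∈ p.divisors, if (x : ℝ) ^ (1 - η) < (d : ℝ) then (moebius d : ℝ) * Real.log d else 0| := by
        refine Finset.sum_congr rfl fun p hp => ?_
        obtain ⟨-, hp, hyp⟩ := Finset.mem_filter.1 hp
        rw [hp.divisors, Finset.sum_pair hp.one_lt.ne, if_pos hyp, ArithmeticFunction.moebius_apply_prime hp]
        have hlog : 0 ≤ Real.log p := Real.log_nonneg (by exact_mod_cast hp.one_lt.le)
        simp [abs_of_nonneg hlog]
    _ ≤ _ := Finset.sum_le_sum_of_subset_of_nonneg (Finset.filter_subset _ _) fun _ _ _ => abs_nonneg _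

/-- Chebyshev's `θ(x)` minus the primes below the cut-off (at most `θ(x^{1-η}) ≤ log 4 · x^{1-η}`). [folklore] -/
theorem theta_sub_le_sum_log (η : ℝ) (x : ℕ) :
    Chebyshev.theta x - Real.log 4 * (x : ℝ) ^ (1 - η)
      ≤ ∑ p ∈ (Finset.Icc 1 x).filter (fun p : ℕ => p.Prime ∧ (x : ℝ) ^ (1 - η) < (p : ℝ)), Real.log p := by
  set y : ℝ := (x : ℝ) ^ (1 - η) with hy
  have hy0 : 0 ≤ y := Real.rpow_nonneg (Nat.cast_nonneg x) _
  have hθ : Chebyshev.theta x = ∑ p ∈ (Finset.Icc 1 x).filter Nat.Prime, Real.log p := by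
    rw [Chebyshev.theta, Nat.floor_natCast]; rfl
  have hsplit := Finset.sum_filter_add_sum_filter_not ((Finset.Icc 1 x).filter Nat.Prime)
    (fun p : ℕ => y < (p : ℝ)) (fun p : ℕ => Real.log p)
  rw [Finset.filter_filter, Finset.filter_filter] at hsplit
  have hsmall : ∑ p ∈ (Finset.Icc 1 x).filter (fun p : ℕ => p.Prime ∧ ¬ y < (p : ℝ)), Real.log p
      ≤ Chebyshev.theta y := by
    rw [Chebyshev.theta]
    refine Finset.sum_le_sum_of_subset_of_nonneg ?_ fun p hp _ => ?_
    · intro p hp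
      simp only [Finset.mem_filter, Finset.mem_Icc, not_lt] at hp
      simp only [Finset.mem_filter, Finset.mem_Ioc]
      exact ⟨⟨hp.1.1, Nat.le_floor hp.2.2⟩, hp.2.1⟩
    · simp only [Finset.mem_filter] at hp
      exact Real.log_nonneg (by exact_mod_cast hp.2.one_lt.le)
  have hθy := Chebyshev.theta_le_log4_mul_x hy0
  linarith

/-- `x ↦ x^s` is `o(x)` at `+∞` for `s < 1`. [folklore] -/
theorem isLittleO_rpow_self_of_lt_one {s : ℝ} (hs : s < 1) :
    (fun x : ℝ => x ^ s) =o[atTop] (fun x : ℝ => x) := by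
  refine (isLittleO_iff_tendsto' ?_).2 ?_
  · filter_upwards [eventually_gt_atTop (0 : ℝ)] with x hx h using absurd h hx.ne'
  · have h := tendsto_rpow_neg_atTop (y := 1 - s) (by linarith)
    refine h.congr' ?_
    filter_upwards [eventually_gt_atTop (0 : ℝ)] with x hx
    rw [neg_sub, Real.rpow_sub_one hx.ne']

/-- For `(X)` and EVERY `η > 0` the absolute tail is not `o(x)`: it is `≥ θ(x) - θ(x^{1-η}) ≫ x`. [folklore] -/
theorem absTail_X_not_isLittleO {η : ℝ} (hη : 0 < η) :
    ¬ (fun x : ℕ => ∑ n ∈ Finset.Icc 1 x,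
        |∑ d ∈ Fintype.piFinset (fun i => (((![(X : ℤ[X])] i).eval (n : ℤ)).toNat).divisors),
          if (x : ℝ) ^ (1 - η) < ∏ i, (d i : ℝ) then ∏ i, ((moebius (d i) : ℝ) * Real.log (d i)) else 0|)
      =o[atTop] (fun x : ℕ => (x : ℝ)) := by
  intro h
  obtain ⟨C, hC⟩ := Chebyshev.psi_sub_theta_le_mul_sqrt
  have h1 : (fun x : ℕ => Real.log 4 * (x : ℝ) ^ (1 - η)) =o[atTop] (fun x : ℕ => (x : ℝ)) :=
    ((isLittleO_rpow_self_of_lt_one (s := 1 - η) (by linarith)).const_mul_left _).comp_tendsto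
      tendsto_natCast_atTop_atTop
  have h2 : (fun x : ℕ => C * Real.sqrt x) =o[atTop] (fun x : ℕ => (x : ℝ)) := by
    have h2' := ((isLittleO_rpow_self_of_lt_one (s := 1 / 2) (by norm_num)).const_mul_left C).comp_tendsto
      tendsto_natCast_atTop_atTop
    refine h2'.congr_left fun x => ?_
    simp [Real.sqrt_eq_rpow]
  have h3 := (h.add h1).add h2
  have h4 : (fun x : ℕ => Chebyshev.psi x) =O[atTop]
      (fun x : ℕ => (∑ n ∈ Finset.Icc 1 x,
        |∑ d ∈ Fintype.piFinset (fun i => (((![(X : ℤ[X])] i).eval (n : ℤ)).toNat).divisors),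
          if (x : ℝ) ^ (1 - η) < ∏ i, (d i : ℝ) then ∏ i, ((moebius (d i) : ℝ) * Real.log (d i)) else 0|)
        + Real.log 4 * (x : ℝ) ^ (1 - η) + C * Real.sqrt x) := by
    refine IsBigO.of_bound 1 (Eventually.of_forall fun x => ?_)
    rw [one_mul, Real.norm_eq_abs, Real.norm_eq_abs, abs_of_nonneg (Chebyshev.psi_nonneg _)]
    refine le_trans ?_ (le_abs_self _)
    have ha := sum_log_le_absTail_X η x
    have hb := theta_sub_le_sum_log η x
    have hc := hC x
    linarith
  have h5 := h4.trans_isLittleO h3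
  exact not_isLittleO_neg_psi (by simpa using h5.neg_left)

/-- **The `|inner sum|`-strengthening of `PolyMobiusTail` is false** (witness `f = (X)`, every `η`):
the `o(x)` of the crux is cancellation between prime and composite `n`, never termwise in `n`. [folklore] -/
theorem polyMobiusTail_abs_false :
    ¬ ∀ (k : ℕ) (f : Fin k → ℤ[X]), IsBatemanHornSystem f → ∃ η : ℝ, 0 < η ∧ η < 1 ∧
      (fun x : ℕ => ∑ n ∈ Finset.Icc 1 x,
        |∑ d ∈ Fintype.piFinset (fun i => (((f i).eval (n : ℤ)).toNat).divisors),
          if (x : ℝ) ^ (1 - η) < ∏ i, (d i : ℝ) then ∏ i, ((moebius (d i) : ℝ) * Real.log (d i)) else 0|)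
      =o[atTop] (fun x : ℕ => (x : ℝ)) := fun h => by
  obtain ⟨η, hη, -, hT⟩ := h 1 ![X] isBatemanHornSystem_X
  exact absTail_X_not_isLittleO hη hT

/-! ### Prime divisor tuples only -/

/-- The PRIME-divisor tail of `(X)` in closed form: restricting the divisor tuples to prime `d` gives
`∑_{n ≤ x} ∑_{p ∣ n, y < p} μ(p) log p = -∑_{y < p ≤ x} log p · ⌊x/p⌋`. [folklore] -/
theorem primeTail_X_eq (η : ℝ) (x : ℕ) :
    (∑ n ∈ Finset.Icc 1 x, ∑ d ∈ Fintype.piFinset (fun i => (((![(X : ℤ[X])] i).eval (n : ℤ)).toNat).primeFactors),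
        if (x : ℝ) ^ (1 - η) < ∏ i, (d i : ℝ) then ∏ i, ((moebius (d i) : ℝ) * Real.log (d i)) else 0)
      = -∑ d ∈ Finset.Ioc 0 x, (if d.Prime ∧ (x : ℝ) ^ (1 - η) < d then Real.log d else 0) * ((x / d : ℕ) : ℝ) := by
  set y : ℝ := (x : ℝ) ^ (1 - η) with hy
  set H : ArithmeticFunction ℝ := ⟨fun d => if d.Prime ∧ y < d then Real.log d else 0, by simp [Nat.not_prime_zero]⟩
    with hH
  have hHapply : ∀ d : ℕ, H d = if d.Prime ∧ y < d then Real.log d else 0 := fun d => rfl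
  have h1 : ∀ n : ℕ, (∑ d ∈ Fintype.piFinset (fun i => (((![(X : ℤ[X])] i).eval (n : ℤ)).toNat).primeFactors),
        if y < ∏ i, (d i : ℝ) then ∏ i, ((moebius (d i) : ℝ) * Real.log (d i)) else 0)
      = -(H * ArithmeticFunction.zeta) n := by
    intro n
    simp only [Fin.prod_univ_one, Matrix.cons_val_fin_one, eval_X, Int.toNat_natCast]
    rw [sum_piFinset_fin_one (fun _ => n.primeFactors)
      (fun j => if y < (j : ℝ) then (moebius j : ℝ) * Real.log j else 0), coe_mul_zeta_apply]
    have hpf : n.primeFactors = n.divisors.filter Nat.Prime := by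
      ext p; simp [Nat.mem_primeFactors, Nat.mem_divisors, and_comm, and_left_comm]
    rw [hpf, Finset.sum_filter, ← Finset.sum_neg_distrib]
    refine Finset.sum_congr rfl fun d hd => ?_
    rw [hHapply]
    by_cases hp : d.Prime
    · simp only [hp, true_and, if_true, ArithmeticFunction.moebius_apply_prime hp]
      split_ifs <;> simp
    · simp [hp]
  have h3 : ∑ n ∈ Finset.Icc 1 x, (H * ArithmeticFunction.zeta) n
      = ∑ d ∈ Finset.Ioc 0 x, H d * ((x / d : ℕ) : ℝ) := by
    rw [← sum_Ioc_mul_zeta_eq_sum H x]; rfl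
  simp only [h1, Finset.sum_neg_distrib, h3, hHapply]

/-- Mertens' first theorem (tree: `abs_mertensTau_le`) bounds the prime-divisor tail of `(X)` from below:
`∑_{y < p ≤ x} log p ⌊x/p⌋ ≥ x (η log x - 8 - log 4)` for `y = x^{1-η}`, `0 < η ≤ 1`, `x ≥ 1`. [folklore] -/
theorem primeTail_X_lower {η : ℝ} (hη0 : 0 < η) (hη1 : η ≤ 1) {x : ℕ} (hx : 1 ≤ x) :
    (x : ℝ) * (η * Real.log x - 8 - Real.log 4)
      ≤ ∑ d ∈ Finset.Ioc 0 x, (if d.Prime ∧ (x : ℝ) ^ (1 - η) < d then Real.log d else 0) * ((x / d : ℕ) : ℝ) := by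
  set y : ℝ := (x : ℝ) ^ (1 - η) with hy
  have hx0 : (0 : ℝ) < x := by exact_mod_cast hx
  have hx1 : (1 : ℝ) ≤ x := by exact_mod_cast hx
  have hy1 : 1 ≤ y := Real.one_le_rpow hx1 (by linarith)
  have hy0 : 0 ≤ y := by linarith
  have hyx : y ≤ x := Real.rpow_le_self_of_one_le hx1 (by linarith)
  have hlogy : Real.log y = (1 - η) * Real.log x := Real.log_rpow hx0 _
  -- (i) replace `⌊x/d⌋` by `x/d - 1`
  have step1 : ∑ d ∈ Finset.Ioc 0 x, (if d.Prime ∧ y < d then Real.log d else 0) * ((x : ℝ) / d - 1)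
      ≤ ∑ d ∈ Finset.Ioc 0 x, (if d.Prime ∧ y < d then Real.log d else 0) * ((x / d : ℕ) : ℝ) := by
    refine Finset.sum_le_sum fun d hd => ?_
    have hd1 : 1 ≤ d := (Finset.mem_Ioc.mp hd).1
    have hw : 0 ≤ (if d.Prime ∧ y < d then Real.log d else 0) := by
      split_ifs
      · exact Real.log_nonneg (by exact_mod_cast hd1)
      · exact le_rfl
    refine mul_le_mul_of_nonneg_left ?_ hw
    rw [← Nat.floor_div_eq_div (K := ℝ)]
    exact (Nat.sub_one_lt_floor _).le
  -- (ii) the two pieces of the left side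
  have hsplit : ∑ d ∈ Finset.Ioc 0 x, (if d.Prime ∧ y < d then Real.log d else 0) * ((x : ℝ) / d - 1)
      = (x : ℝ) * ∑ d ∈ Finset.Ioc 0 x, (if d.Prime ∧ y < d then Real.log d / d else 0)
        - ∑ d ∈ Finset.Ioc 0 x, (if d.Prime ∧ y < d then Real.log d else 0) := by
    rw [Finset.mul_sum, ← Finset.sum_sub_distrib]
    refine Finset.sum_congr rfl fun d hd => ?_
    have hd0 : (d : ℝ) ≠ 0 := by exact_mod_cast (Finset.mem_Ioc.mp hd).1.ne'
    split_ifs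
    · field_simp
    · simp
  -- (iii) the `log p / p` sum is `S(x) - S(y)` with `S = primeLogDivSum`
  have hS : ∑ d ∈ Finset.Ioc 0 x, (if d.Prime ∧ y < d then Real.log d / d else 0)
      = Literature.NumberTheory.LFunctions.Mertens.primeLogDivSum x
        - Literature.NumberTheory.LFunctions.Mertens.primeLogDivSum y := by
    rw [Literature.NumberTheory.LFunctions.Mertens.primeLogDivSum, Literature.NumberTheory.LFunctions.Mertens.primeLogDivSum,
      Nat.floor_natCast, ← Finset.sum_filter]
    have hA : (Finset.Ioc 0 x).filter (fun d : ℕ => d.Prime ∧ y < d) = (Nat.primesLE x).filter (fun p : ℕ => y < p) := by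
      ext d
      simp only [Finset.mem_filter, Finset.mem_Ioc, Nat.mem_primesLE]
      constructor
      · rintro ⟨⟨-, hdx⟩, hp, hyd⟩; exact ⟨⟨hdx, hp⟩, hyd⟩
      · rintro ⟨⟨hdx, hp⟩, hyd⟩; exact ⟨⟨hp.pos, hdx⟩, hp, hyd⟩
    have hB : (Nat.primesLE x).filter (fun p : ℕ => ¬ y < p) = Nat.primesLE ⌊y⌋₊ := by
      ext p
      simp only [Finset.mem_filter, Nat.mem_primesLE, not_lt]
      constructor
      · rintro ⟨⟨-, hp⟩, hpy⟩; exact ⟨Nat.le_floor hpy, hp⟩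
      · rintro ⟨hpf, hp⟩
        have hpy : (p : ℝ) ≤ y := (Nat.le_floor_iff hy0).mp hpf
        exact ⟨⟨by exact_mod_cast hpy.trans hyx, hp⟩, hpy⟩
    rw [hA, ← hB]
    have := Finset.sum_filter_add_sum_filter_not (Nat.primesLE x) (fun p : ℕ => y < p)
      (fun p : ℕ => Real.log p / p)
    linarith
  -- (iv) Mertens at `x` and at `y`
  have hMx := Literature.NumberTheory.LFunctions.Mertens.abs_mertensTau_le hx1
  have hMy := Literature.NumberTheory.LFunctions.Mertens.abs_mertensTau_le hy1
  rw [Literature.NumberTheory.LFunctions.Mertens.mertensTau, abs_le] at hMx hMy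
  -- (v) the `log p` sum is at most `θ(x) ≤ x log 4`
  have hθ : ∑ d ∈ Finset.Ioc 0 x, (if d.Prime ∧ y < d then Real.log d else 0) ≤ Real.log 4 * x := by
    refine le_trans ?_ (Chebyshev.theta_le_log4_mul_x hx0.le)
    rw [Chebyshev.theta, Nat.floor_natCast, Finset.sum_filter]
    refine Finset.sum_le_sum fun d hd => ?_
    have hd1 : 1 ≤ d := (Finset.mem_Ioc.mp hd).1
    have hlog : 0 ≤ Real.log d := Real.log_nonneg (by exact_mod_cast hd1)
    split_ifs with h1 h2 h2 <;> first | exact le_rfl | exact hlog | exact absurd h1.1 h2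
  -- assemble
  refine le_trans ?_ step1
  rw [hsplit, hS]
  rw [hlogy] at hMy
  nlinarith [hMx.1, hMy.2, hθ, hx0]

/-- **The prime-divisor restriction of `PolyMobiusTail` fails for `(X)` at EVERY `η ∈ (0,1)`**: keeping
only prime `d` in the divisor sum leaves `-∑_{x^{1-η} < p ≤ x} log p ⌊x/p⌋ ≈ -η·x·log x`. So the
cancellation in the crux also runs across the divisor lattice (prime against composite `d`), not only
across `n`. [folklore] -/
theorem primeTail_X_not_isLittleO {η : ℝ} (hη0 : 0 < η) (hη1 : η < 1) :
    ¬ (fun x : ℕ => ∑ n ∈ Finset.Icc 1 x,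
        ∑ d ∈ Fintype.piFinset (fun i => (((![(X : ℤ[X])] i).eval (n : ℤ)).toNat).primeFactors),
          if (x : ℝ) ^ (1 - η) < ∏ i, (d i : ℝ) then ∏ i, ((moebius (d i) : ℝ) * Real.log (d i)) else 0)
      =o[atTop] (fun x : ℕ => (x : ℝ)) := by
  intro h
  have hev := h.def one_pos
  have hlog : ∀ᶠ x : ℕ in atTop, 10 + Real.log 4 ≤ η * Real.log x := by
    have ht : Tendsto (fun x : ℕ => η * Real.log x) atTop atTop :=
      (Real.tendsto_log_atTop.comp tendsto_natCast_atTop_atTop).const_mul_atTop hη0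
    exact ht.eventually_ge_atTop _
  obtain ⟨x, hx, hlx, hx1⟩ := (hev.and (hlog.and (eventually_ge_atTop 1))).exists
  rw [primeTail_X_eq, norm_neg, Real.norm_eq_abs, Real.norm_eq_abs, one_mul,
    abs_of_nonneg (Nat.cast_nonneg x : (0 : ℝ) ≤ (x : ℝ))] at hx
  have hlow := primeTail_X_lower hη0 hη1.le hx1
  have hx0 : (1 : ℝ) ≤ x := by exact_mod_cast hx1
  have := le_trans hlow (le_abs_self _)
  nlinarith

/-- **NATURAL STRENGTHENING 3 (refuted): prime divisor tuples only.** [folklore] -/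
theorem polyMobiusTail_primeDivisors_false :
    ¬ ∀ (k : ℕ) (f : Fin k → ℤ[X]), IsBatemanHornSystem f → ∃ η : ℝ, 0 < η ∧ η < 1 ∧
      (fun x : ℕ => ∑ n ∈ Finset.Icc 1 x,
        ∑ d ∈ Fintype.piFinset (fun i => (((f i).eval (n : ℤ)).toNat).primeFactors),
          if (x : ℝ) ^ (1 - η) < ∏ i, (d i : ℝ) then ∏ i, ((moebius (d i) : ℝ) * Real.log (d i)) else 0)
      =o[atTop] (fun x : ℕ => (x : ℝ)) := fun h => by
  obtain ⟨η, hη0, hη1, hT⟩ := h 1 ![X] isBatemanHornSystem_X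
  exact primeTail_X_not_isLittleO hη0 hη1 hT

end Summit.Parity.BatemanHorn.Theorems.PolyMobiusTail.Negative
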